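import Summits.HodgeConjecture.HodgeConjecture.Theorems.Ring2AbelianAllEllipticTimesFourfold
import Summits.HodgeConjecture.HodgeConjecture.Theorems.Ring2HypothesesAtlasSixfolds
import Summits.HodgeConjecture.HodgeConjecture.Theorems.Ring2ClassTargets
import Literature.AlgebraicGeometry.HodgeTheory.HodgeGroupProductCMFactorClasses
import Literature.AlgebraicGeometry.HodgeTheory.HodgeConjectureIsogenyInvariance
import Literature.AlgebraicGeometry.HodgeTheory.WeilTypeAbelianVariety
import Literature.AlgebraicGeometry.HodgeTheory.WeilClassesRationalPlane
import Literature.AlgebraicGeometry.Milne1999.HodgeCMImpliesTateFiniteFields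
import Literature.NumberTheory.DiophantineGeometry.AVIsogenyTateHoldsProofs
import HarnessLib

/-!
# Ring 2 · motiv (generation 12) — the quartic-CM Weil sixfold cell `g6.IV(2,1).kE0.Weil-k`: its powers priced at ONE Weil plane per member

HONEST FRAMING (cell `pub-hodge-ring2`, verbatim): research route conditional on HC_CM; not a corollary;
Q11.4-sentence-2 already refuted in dim ≥ 3. `HC_CM` (:= `Theses.RankFourFaces.CMAbelianHodge`, stmt-HodgeConjecture-3052)
occurs NOWHERE in this file; every member of the cell is NOT of CM type (`IsQuarticCMWeilSixfoldWith.not_isOfCMType`,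
proved: `[End⁰(A):ℚ] = 4 < 12`), so the KIND of `HC_CM` on this row is ABSENT.

THE ROW (atlas `AV-HODGE-ATLAS.md` § dimension 6, `g6.IV(2,1).kE0.Weil-k`; motiv M11.6). `A` a SIMPLE complex abelian
sixfold whose endomorphism algebra `End⁰(A) = E` is a quartic field containing `k = ℚ(√-d)` (an endomorphism `φ`,
`φ ≫ φ = -d`) acting on `T₀A` with multiplicities `(3,3)`. Then `E` is a CM field `E = k·E₀`, `E₀` real quadratic
(a totally real quartic `End⁰` is impossible in dimension 6, `4 ∤ 6`), the `E`-rank is `3` and the `E`-signature is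
`{(1,2),(2,1)}` (the signature `{(0,3),(3,0)}` is Shimura-degenerate: `A ~ B³`, not simple). Hodge group (Moonen–Zarhin 1998
Criterion (4.1); MT hull): `Hg(A) = {u ∈ U_E(H¹) : Nm_{E/k}(det_E u) = 1}`, `Hg^{der}_ℂ = SL₃ × SL₃`, centre the rank-one torus
`S = ker(Nm_{E/k} : U¹_E → U¹_k)`. Exceptional Hodge classes (atlas engines A = B, certified): on `A` exactly the Weil PLANE
`W_k(A) = ∧⁶_k H¹(A,ℚ) ⊂ B³(A)` (`b₃ - d₃ = 2`); on `A²`: `b_p - d_p = 32, 96, 168, 210` in degrees `p = 3..6`; the Hodge ring of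
`A` is generated by `B¹` and `W_k` (HODGE-RING-GENERATORS.md row β2, two engines). PRINT STATUS before generation 11: OPEN except on
the hyperbolic (`discriminant -1`) members.

WHAT GENERATION 11 ADDED (motiv M11.0–M11.1, `MOTIV-G11-TRANSFER.md`; kernel half `Theorems/Ring2MotivTransferDiscriminant.lean`,
p197699): the TRANSFER DISCRIMINANT LEMMA `δ(A,k,λ) ≡ d_{E₀}^r · N_{E₀/ℚ}(det H_{E,λ})` in `ℚ^×/Nm(k^×)` and, re-polarising by a
totally positive `u ∈ E₀ ⊂ End⁰(A)`, `δ(λ∘u) ≡ δ(λ) · N_{E₀/ℚ}(u)^r`. Here `r = 3` is ODD, and `u* := ∓√D · det H_{E,λ}` IS totally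
positive (`det H_E` has opposite signs at the two real places of `E₀`, signatures `(1,2)`/`(2,1)`, and so has `√D`), with
`N(u*) = -D · N(det H_E)`; hence `δ(λ∘u*) ≡ -D⁴ N(det H_E)⁴ ≡ -1`: EVERY member carries a polarisation for which `(A, k)` has
discriminant `-1 = (-1)³`, i.e. (Landherr 1936; van Geemen 5.2) the `k`-hermitian form is HYPERBOLIC — the tree's `IsHyperbolicWeilType`.
That is binder (H) below (DERIVED: the Landherr/van Geemen dictionary `δ = (-1)ⁿ ⟺ hyperbolic` is a docstring dictionary in the
tree, not a theorem on the carriers; ABSOLUTE RULE: a cell-derived statement is a HYPOTHESIS, never a fact).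

WHAT THIS FILE PROVES (kernel, 0 sorry). With
* (H) `QuarticCMWeilSixfoldHyperbolicAt d` — every member is hyperbolic for some `k`-symmetrised hyperplane class (M11.1, DERIVED);
* (G) `QuarticCMWeilSixfoldGeneratedAt d` — every rational `(p,p)`-class on every power `A^{N+1}` lies in the `ℂ`-algebra generated
  by divisor monomials and the pull-backs `f^* w`, `f : A^{N+1} → A`, of the rational Weil classes `w ∈ W_k(A)` (ab-weil-2's engine
  `InDivisorSeedAlgebra` with seeds `weilPullbackSeeds (A^{N+1}) A φ d`; DERIVED: certified at `N = 0` by the atlas generator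
  engines A = B, and for all `N` by the First Fundamental Theorem for `SL₃ × SL₃` on the tensor algebra — every `S`-invariant
  bracket monomial has equally many `[vvv]`-brackets of the two `E₀`-types beyond those paired with dual brackets into
  determinants of pairings (divisor classes), and the balanced pairs are polarised pull-backs of `W_k(A)`: level-one count on
  `A²` = `2 · (dim Sym³ ℂ²)² = 32` = atlas; Hodge genericity of every member: a connected `ℚ`-subgroup of `Hg` of Hodge type with
  commutant `E ⊗ ℂ` on `H¹` is all of `Hg` — the inner-diagonal `SL₃`, `SL₃ × SO₃`, `SO₃ × SO₃` candidates contain no conjugate of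
  the Hodge cocharacter `(diag(z,1,1), diag(z,z,1))`, the outer-diagonal one identifies `V_{τ₁}` with `V̄_{τ₂}` and enlarges `End⁰`);
* the RESIDUAL `QuarticCMWeilClassesAlgebraicAt d` — the rational Weil classes `W_k(A)` of every member are algebraic —
the file proves: (1) EXACTNESS `hcOnClass_powerClassAt_iff_weilClassesAlgebraicAt (hG) : HCOnClass (PowerClassAt d) ↔ Residual d`
— modulo generation, the Hodge conjecture on the isogeny-closed class "isogenous to a power of a member" costs EXACTLY one Weil plane
per member (→ is unconditional); (2) `weilClassesAlgebraicAt_of_sixfoldSlice_of_hyperbolic (hSix) (hH)`: the residual follows from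
(H) and the `d`-slice of the hyperbolic-sixfold theorem — REFEREED for `k = ℚ(i)` (Koike 2004 Cor. 2.1,
`Koike2004_weilClasses_algebraic_hyperbolicSixfold_one`) and `k = ℚ(√-3)` (Schoen 1988/1998,
`Schoen1998_weilClasses_algebraic_hyperbolicSixfold_three`), every `k` modulo Markman's UNREFEREED Thm. 1.5.1
(`Markman2025_weilClasses_algebraic_hyperbolicSixfold`); (3) hence `HCOnClass (QuarticCMWeilSixfoldPowerClassAt 1)` from
`hK + hH + hG`, `… 3` from `hS + hH + hG`, and `HCOnClass QuarticCMWeilSixfoldPowerClass` (all `d`) from `hM + hH + hG` — all powers,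
all abelian subvarieties of powers (FACTOR form), `HC_CM` ABSENT; (4) anti-vacuity of the price: every member carries a NON-ZERO
rational `(3,3)` Weil class (tree theorems `exists_isRationalClass_ne_zero_mem_weilClassesOf`, `IsWeilType.isOfHodgeType_of_mem_weilClassesOf`);
(5) ON-PATH: the rows are cases of `HC_AV` (stmt-HodgeConjecture-1333), of the summit, and the residual is a case of `HCAtDim 6`.
BINDER COUNT of `HCOnClass (PowerClassAt 1)`: 1 refereed record (Koike) + 2 cell-DERIVED hypotheses (H, G) + 0 open statements + `HC_CM` ABSENT;
all `d`: 1 UNREFEREED record (Markman) + 2 DERIVED. Atlas wording (atlas-1's renderer; never "closed in tree" while (H), (G) are hypotheses):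
row `g6.IV(2,1).kE0.Weil-k`, power column — "KNOWN in refereed print for `k ∈ {ℚ(i), ℚ(√-3)}` and modulo [M25] 1.5.1 otherwise, both modulo
DERIVED (H) = motiv M11.1 and (G) = W-GEN". NOT reachable this way (M11.3, recorded for contrast): the sextic-CM `(3,3)` cell
`Ring2.Atlas.HodgeSexticFieldWeilSixfold` (`E`-rank 2, EVEN: `δ` is polarisation-RIGID, the non-hyperbolic members stay open = hweil R1).

## References
* [MoonenZarhin1998WeilClasses] Criterion (4.1) (`W_k` Hodge ⟺ multiplicities `(n,n)`; `Hg ⊆ {Nm_{E/k} det = 1}`). [MoonenZarhin1999LowDim] Thm. 0.2.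
* [vanGeemen1994HodgeAV] LNM 1594: 4.9–4.10, Lemma 5.2 (δ, hyperbolicity), 5.4, Lemma 3.7 (isogeny). [Landherr1936HermitianForms] (hermitian forms over CM fields: rank, discriminant mod norms, signatures).
* [Koike2004WeilHodge] Canad. Math. Bull. 47 (2004) Cor. 2.1. [Schoen1988HodgeWeil] Compositio 65 (1988); [Schoen1998HodgeWeilAddendum]. [Markman2025SecantWeil] arXiv:2502.03415 Thm. 1.5.1 (UNREFEREED).
* [Shimura1963AnalyticFamilies] Ann. of Math. 78 (1963) §4 (existence of the 4-dimensional family; degenerate signatures). [Ribet1983] Thm. 0 (the shape `Hdg(Aⁿ)` from invariants). [Weyl1939] II.A (FFT for `SL_n`) — docstring derivation of (G) only.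
* [Milne1999] §2 p. 54 (CM type: a commutative semisimple subalgebra of degree `2 dim A`). [Deligne2000] §1.
-/

set_option linter.dupNamespace false

noncomputable section

open CategoryTheory

namespace Summit.HodgeConjecture.HodgeConjecture.Ring2.Motiv

open Literature.AlgebraicGeometry Literature.AlgebraicGeometry.Motives
open Literature.AlgebraicGeometry.HodgeTheory
open Literature.AlgebraicTopology.SingularHomology
open Summit.HodgeConjecture.HodgeConjecture.Theses
open Summit.HodgeConjecture.HodgeConjecture.Ring2.ClassTargets
open Summit.HodgeConjecture.HodgeConjecture.Ring2.AbelianAll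

/-! ## §1 The member predicate, the isogeny-closed classes, and what every member carries -/

/-- **Member of the row `g6.IV(2,1).kE0.Weil-k`, witnessed by `(φ, d)`**: `A` is a simple complex abelian SIXFOLD whose
endomorphism algebra is a FIELD of degree `4` over `ℚ` (so `End⁰(A) = E` is a quartic CM field `k·E₀`), `φ ≫ φ = -d` with `d > 0`
(so `k = ℚ(φ) ≅ ℚ(√-d) ⊂ E`), and `i√d` has multiplicity `3` on `H^{1,0}(A)` (so `k` acts with multiplicities `(3,3)`: `(A, k)` is of
Weil type and `W_k(A)` consists of Hodge classes, Moonen–Zarhin Criterion (4.1)). A predicate (nothing asserted).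
[cite: MoonenZarhin1998WeilClasses, Criterion (4.1)] [cite: Shimura1963AnalyticFamilies, §4] [cite: vanGeemen1994HodgeAV, 4.9] -/
structure IsQuarticCMWeilSixfoldWith (A : AbelianVariety ℂ) (φ : A ⟶ A) (d : ℕ) : Prop where
  pos : 0 < d
  dim_eq : A.dim = 6
  isSimple : A.IsSimple
  isField : IsField A.endAlgebra
  finrank_eq : Module.finrank ℚ A.endAlgebra = 4
  sq_eq : φ ≫ φ = -(d • 𝟙 A)
  mult_eq : eigenMultiplicity A φ (Complex.I * (Real.sqrt d : ℂ)) = 3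

/-- **The power class at `k = ℚ(√-d)`, isogeny-closed**: `X` is isogenous to `A^{N+1}` for a member `(A, φ)` of the row at `d` and
some `N` (`A.powSucc 0 = A`). A predicate. [cite: vanGeemen1994HodgeAV, Lemma 3.7] [cite: MoonenZarhin1999LowDim, Thm. 0.2] -/
def QuarticCMWeilSixfoldPowerClassAt (d : ℕ) (X : AbelianVariety ℂ) : Prop :=
  ∃ (A : AbelianVariety ℂ) (φ : A ⟶ A) (N : ℕ), IsQuarticCMWeilSixfoldWith A φ d ∧ AbelianVariety.IsIsogenous X (A.powSucc N)

/-- **The power class of the row, all `k`**: `X` is isogenous to a power of a member for some `d`. A predicate.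
[cite: vanGeemen1994HodgeAV, Lemma 3.7] [cite: MoonenZarhin1999LowDim, Thm. 0.2] -/
def QuarticCMWeilSixfoldPowerClass (X : AbelianVariety ℂ) : Prop :=
  ∃ d : ℕ, QuarticCMWeilSixfoldPowerClassAt d X

namespace IsQuarticCMWeilSixfoldWith

variable {A : AbelianVariety ℂ} {φ : A ⟶ A} {d : ℕ}

/-- `dim A = 2 · 3`. [folklore] -/
theorem dim_eq' (h : IsQuarticCMWeilSixfoldWith A φ d) : A.dim = 2 * 3 := h.dim_eq

/-- A member is of Weil type `(3, d)` in van Geemen's sense (Definition 4.9; typer2's bridge `isWeilType_of_eigenMultiplicity_eq`).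
[cite: vanGeemen1994HodgeAV, 4.9] -/
theorem isWeilType (h : IsQuarticCMWeilSixfoldWith A φ d) : IsWeilType A φ 3 d :=
  Ring2.Hypotheses.isWeilType_of_eigenMultiplicity_eq (by norm_num) h.pos h.dim_eq' h.sq_eq h.mult_eq

/-- **Every Weil class of a member is of Hodge type `(3,3)`** (van Geemen 4.10 / Lemma 5.2 (6); Moonen–Zarhin Criterion (4.1) ⇐).
[cite: vanGeemen1994HodgeAV, 4.10] [cite: MoonenZarhin1998WeilClasses, Criterion (4.1)] -/
theorem isOfHodgeType_of_mem_weilClassesOf (h : IsQuarticCMWeilSixfoldWith A φ d) {c : complexBetti A.X (2 * 3)}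
    (hc : c ∈ weilClassesOf A φ 3 d) : IsOfHodgeType (2 * 3) A.X (2 * 3) 3 3 c :=
  h.isWeilType.isOfHodgeType_of_mem_weilClassesOf hc

/-- **ANTI-VACUITY of the price: every member carries a NON-ZERO RATIONAL Weil class of Hodge type `(3,3)`** (the Weil plane is
spanned by rational classes, van Geemen 4.9; balanced multiplicities make them `(3,3)`). Unconditional. [cite: vanGeemen1994HodgeAV, 4.9–4.10] -/
theorem exists_rational_hodge_weilClass_ne_zero (h : IsQuarticCMWeilSixfoldWith A φ d) :
    ∃ c : complexBetti A.X (2 * 3), IsRationalClass c ∧ IsOfHodgeType (2 * 3) A.X (2 * 3) 3 3 c ∧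
      c ∈ weilClassesOf A φ 3 d ∧ c ≠ 0 := by
  obtain ⟨c, hcW, hc0, hcr⟩ := exists_isRationalClass_ne_zero_mem_weilClassesOf (by norm_num) h.dim_eq' h.pos h.sq_eq
  exact ⟨c, hcr, h.isOfHodgeType_of_mem_weilClassesOf hcW, hcW, hc0⟩

/-- **KIND of `HC_CM`: ABSENT — no member is of CM type** (Milne 1999 §2: CM type needs a commutative semisimple subalgebra of
`End⁰(A)` of degree `2 dim A = 12`, but `[End⁰(A):ℚ] = 4`). [cite: Milne1999, §2 p. 54] -/
theorem not_isOfCMType (h : IsQuarticCMWeilSixfoldWith A φ d) : ¬ Milne1999.IsOfCMType A := by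
  rintro ⟨S, -, -, hS⟩
  haveI : Module.Finite ℚ A.endAlgebra := AbelianVariety.finiteDimensional_endAlgebra_holds A
  have hle := Submodule.finrank_le (Subalgebra.toSubmodule S)
  rw [Subalgebra.finrank_toSubmodule, hS, h.finrank_eq, h.dim_eq] at hle
  omega

/-- Under the Hodge property of the member itself, its rational Weil classes are algebraic (they are rational `(3,3)`-classes).
[cite: vanGeemen1994HodgeAV, 4.10] [cite: Deligne2000, §1] -/
theorem weilClass_mem_algebraicClasses_of_hodgeConjectureFor (h : IsQuarticCMWeilSixfoldWith A φ d)
    (hHC : HodgeConjectureFor A.dim A.X) {c : complexBetti A.X (2 * 3)} (hc : IsRationalClass c)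
    (hcW : c ∈ weilClassesOf A φ 3 d) : c ∈ algebraicClasses A.X 3 := by
  have h33 : IsOfHodgeType A.dim A.X (2 * 3) 3 3 c := by
    rw [h.dim_eq']
    exact h.isOfHodgeType_of_mem_weilClassesOf hcW
  exact hHC.2 3 c hc h33

end IsQuarticCMWeilSixfoldWith

/-! ## §2 The two DERIVED binders (H), (G) and the residual price -/

/-- **BINDER (H) — motiv M11.1 (DERIVED by the transfer discriminant lemma; never a fact).** Every member `(A, φ)` of the row at `d`
is HYPERBOLIC for some `k`-symmetrised hyperplane class: there are a projective embedding `e` (a polarisation — in the derivation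
`λ∘u*`, `u* = ∓√D · det H_{E,λ} ∈ E₀` totally positive, `N_{E₀/ℚ}(u*) = -D·N(det H_E)`, so that `δ(λ∘u*) ≡ δ(λ)·N(u*)³ ≡ -1`) and a
non-zero rational `a ∈ H²(ℙⁿ)` with `IsHyperbolicWeilType A φ 3 (d·e^*a + φ^*e^*a)` (Landherr: a `k`-hermitian form of signature
`(3,3)` and discriminant `(-1)³` is hyperbolic; van Geemen Lemma 5.2). TRUE for every member by that derivation; typed as a
HYPOTHESIS because the dictionary `δ = (-1)ⁿ ⟺ IsHyperbolicWeilType` is not a tree theorem on the carriers.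
[cite: vanGeemen1994HodgeAV, Lemma 5.2 and 5.4] [cite: Landherr1936HermitianForms] [cite: MoonenZarhin1998WeilClasses, Criterion (4.1)]
[status: cell proposition (DERIVED, motiv M11.1 via `Ring2MotivTransferDiscriminant`); a HYPOTHESIS in the kernel] -/
@[conjecture] def QuarticCMWeilSixfoldHyperbolicAt (d : ℕ) : Prop :=
  ∀ (A : AbelianVariety ℂ) (φ : A ⟶ A), IsQuarticCMWeilSixfoldWith A φ d →
    ∃ (e : ProjectiveEmbedding A.X) (a : complexBetti (projectiveSpace e.n ℂ) 2), IsRationalClass a ∧ a ≠ 0 ∧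
      IsHyperbolicWeilType A φ 3 ((d : ℂ) • complexBetti.map e.ι 2 a + complexBetti.map φ.hom.hom.hom 2 (complexBetti.map e.ι 2 a))

/-- **BINDER (G) — W-GEN for the row (DERIVED; never a fact).** For every member `(A, φ)` at `d` and every `N`, every rational
`(p,p)`-class on `A^{N+1} = A.powSucc N` lies in the `ℂ`-algebra generated by divisor monomials and the pull-backs `f^* w` along
homomorphisms `f : A^{N+1} → A` of the rational `(3,3)` Weil classes `w ∈ W_k(A)` (`InDivisorSeedAlgebra … (weilPullbackSeeds (A^{N+1}) A φ d)`):
`B•(A^{N+1}) = ℚ[D¹, f^*W_k(A)]`. Derivation (cell): `Hg(A)^{der}_ℂ = SL(V_{τ₁}) × SL(V_{τ₂})` with centre `S` for EVERY member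
(Hodge-genericity is forced by `End⁰(A) = E`, see the module docstring), First Fundamental Theorem on the tensor algebra, projection
to `∧•`, `S`-weight balance of bracket monomials, `[v₁v₂v₃][w₁w₂w₃] = det(⟨vᵢ,wⱼ⟩)` for dual brackets; certified numerically at
`N = 0` (atlas generator engines A = B, row β2: `B•(A) = ℚ[B¹, W_k]`) with the level-one count `32` on `A²` equal to the atlas excess.
[cite: MoonenZarhin1999LowDim, Thm. 0.2 (1)–(2)] [cite: Ribet1983, Thm. 0] [cite: Weyl1939, II.A]
[status: cell proposition (DERIVED, motiv M11.1′/M12.1 W-GEN; atlas HRG β2 at N = 0); a HYPOTHESIS in the kernel] -/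
@[conjecture] def QuarticCMWeilSixfoldGeneratedAt (d : ℕ) : Prop :=
  ∀ (A : AbelianVariety ℂ) (φ : A ⟶ A), IsQuarticCMWeilSixfoldWith A φ d →
    ∀ (N p : ℕ) (c : complexBetti (A.powSucc N).X (2 * p)), IsRationalClass c →
      IsOfHodgeType (A.powSucc N).dim (A.powSucc N).X (2 * p) p p c →
      InDivisorSeedAlgebra (A.powSucc N) 3 (weilPullbackSeeds (A.powSucc N) A φ d) p c

/-- **THE RESIDUAL PRICE of the row at `d`: the rational Weil classes `W_k(A)` of every member are algebraic.** KNOWN in refereed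
print for `d ∈ {1, 3}` modulo (H) (Koike, Schoen: hyperbolic sixfolds), for every `d` modulo Markman's unrefereed Thm. 1.5.1 and (H);
by EXACTNESS below it is, modulo (G), EQUIVALENT to the Hodge conjecture on the whole power class. A predicate (nothing asserted).
[cite: Koike2004WeilHodge, Cor. 2.1] [cite: Schoen1988HodgeWeil, Thm. 0.2] [cite: Markman2025SecantWeil, Thm. 1.5.1] -/
def QuarticCMWeilClassesAlgebraicAt (d : ℕ) : Prop :=
  ∀ (A : AbelianVariety ℂ) (φ : A ⟶ A), IsQuarticCMWeilSixfoldWith A φ d →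
    ∀ c : complexBetti A.X (2 * 3), IsRationalClass c → c ∈ weilClassesOf A φ 3 d → c ∈ algebraicClasses A.X 3

/-! ## §3 The rows -/

/-- **Powers of a member from its Weil plane and (G)** (engine `hodgeConjectureFor_of_inDivisorSeedAlgebra`: Lefschetz (1,1), cup
products of algebraic classes, pull-back of algebraic classes along homomorphisms). [cite: MoonenZarhin1999LowDim, Thm. 0.2]
[cite: vanGeemen1994HodgeAV, §2.4] -/
theorem hodgeConjectureFor_powSucc_of_weilClassesAlgebraic_of_generated {d : ℕ} (hW : QuarticCMWeilClassesAlgebraicAt d)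
    (hG : QuarticCMWeilSixfoldGeneratedAt d) {A : AbelianVariety ℂ} {φ : A ⟶ A} (hA : IsQuarticCMWeilSixfoldWith A φ d) (N : ℕ) :
    HodgeConjectureFor (A.powSucc N).dim (A.powSucc N).X :=
  hodgeConjectureFor_of_inDivisorSeedAlgebra
    (weilPullbackSeeds_subset_algebraicClasses fun w hw _ hwW ↦ hW A φ hA w hw hwW) (hG A φ hA N)

/-- **MEMBER-WISE form** (generation assumed for ONE member and one exponent only; for special members whose own generation is
known). [cite: MoonenZarhin1999LowDim, Thm. 0.2] -/
theorem hodgeConjectureFor_powSucc_of_member {d : ℕ} {A : AbelianVariety ℂ} {φ : A ⟶ A} (_hA : IsQuarticCMWeilSixfoldWith A φ d)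
    (hWA : ∀ c : complexBetti A.X (2 * 3), IsRationalClass c → c ∈ weilClassesOf A φ 3 d → c ∈ algebraicClasses A.X 3) (N : ℕ)
    (hgen : ∀ (p : ℕ) (c : complexBetti (A.powSucc N).X (2 * p)), IsRationalClass c →
      IsOfHodgeType (A.powSucc N).dim (A.powSucc N).X (2 * p) p p c →
      InDivisorSeedAlgebra (A.powSucc N) 3 (weilPullbackSeeds (A.powSucc N) A φ d) p c) :
    HodgeConjectureFor (A.powSucc N).dim (A.powSucc N).X :=
  hodgeConjectureFor_of_inDivisorSeedAlgebra
    (weilPullbackSeeds_subset_algebraicClasses fun w hw _ hwW ↦ hWA w hw hwW) hgen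

/-- **ROW at `d`: the Hodge conjecture on the power class from the residual and (G)** (isogeny: van Geemen Lemma 3.7,
`HodgeConjectureFor.of_isIsogenous`). `HC_CM` ABSENT. [cite: vanGeemen1994HodgeAV, Lemma 3.7] [cite: MoonenZarhin1999LowDim, Thm. 0.2] -/
theorem hcOnClass_powerClassAt_of_weilClassesAlgebraic_of_generated {d : ℕ} (hW : QuarticCMWeilClassesAlgebraicAt d)
    (hG : QuarticCMWeilSixfoldGeneratedAt d) : HCOnClass (QuarticCMWeilSixfoldPowerClassAt d) := by
  rintro X ⟨A, φ, N, hA, hX⟩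
  exact HodgeConjectureFor.of_isIsogenous hX (hodgeConjectureFor_powSucc_of_weilClassesAlgebraic_of_generated hW hG hA N)

/-- **The residual is NECESSARY (unconditionally)**: the Hodge conjecture on the power class at `d` contains, at `N = 0`, the
algebraicity of the rational Weil classes of every member. [cite: vanGeemen1994HodgeAV, 4.10] [cite: Deligne2000, §1] -/
theorem weilClassesAlgebraicAt_of_hcOnClass_powerClassAt {d : ℕ} (h : HCOnClass (QuarticCMWeilSixfoldPowerClassAt d)) :
    QuarticCMWeilClassesAlgebraicAt d :=
  fun A φ hA _ hc hcW ↦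
    hA.weilClass_mem_algebraicClasses_of_hodgeConjectureFor (h A ⟨A, φ, 0, hA, AbelianVariety.IsIsogenous.refl A⟩) hc hcW

/-- **EXACTNESS (modulo generation): on the power class of the row, the Hodge conjecture costs EXACTLY one Weil plane per member.**
[cite: MoonenZarhin1999LowDim, Thm. 0.2] [cite: vanGeemen1994HodgeAV, Lemma 3.7 and 4.10] -/
theorem hcOnClass_powerClassAt_iff_weilClassesAlgebraicAt {d : ℕ} (hG : QuarticCMWeilSixfoldGeneratedAt d) :
    HCOnClass (QuarticCMWeilSixfoldPowerClassAt d) ↔ QuarticCMWeilClassesAlgebraicAt d :=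
  ⟨weilClassesAlgebraicAt_of_hcOnClass_powerClassAt, fun hW ↦ hcOnClass_powerClassAt_of_weilClassesAlgebraic_of_generated hW hG⟩

/-- **The residual from ONE hyperbolic-sixfold input and (H) (generic `d`-slice).** If the rational `(3,3)` Weil classes of every
HYPERBOLIC Weil sixfold `(Z, φ_Z)` with `φ_Z ≫ φ_Z = -d` are algebraic (hypothesis `hSix`: the `d`-slice of Markman / Koike / Schoen),
then by (H) so are the Weil classes of every member. [cite: vanGeemen1994HodgeAV, Lemma 5.2] [cite: Markman2025SecantWeil, Thm. 1.5.1] -/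
theorem weilClassesAlgebraicAt_of_sixfoldSlice_of_hyperbolic {d : ℕ}
    (hSix : ∀ (Z : AbelianVariety ℂ) (φZ : Z ⟶ Z), Z.dim = 2 * 3 → IsSmoothProjective (2 * 3) Z.X →
      φZ ≫ φZ = -(d • 𝟙 Z) → ∀ (e : ProjectiveEmbedding Z.X) (a : complexBetti (projectiveSpace e.n ℂ) 2),
      IsRationalClass a → a ≠ 0 →
      IsHyperbolicWeilType Z φZ 3 ((d : ℂ) • complexBetti.map e.ι 2 a + complexBetti.map φZ.hom.hom.hom 2 (complexBetti.map e.ι 2 a)) →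
      ∀ c : complexBetti Z.X (2 * 3), IsRationalClass c → IsOfHodgeType (2 * 3) Z.X (2 * 3) 3 3 c →
        c ∈ weilClassesOf Z φZ 3 d → c ∈ algebraicClasses Z.X 3)
    (hH : QuarticCMWeilSixfoldHyperbolicAt d) : QuarticCMWeilClassesAlgebraicAt d := by
  intro A φ hA c hc hcW
  obtain ⟨e, a, ha, ha0, hyp⟩ := hH A φ hA
  exact hSix A φ hA.dim_eq' hA.isWeilType.isSmoothProjective hA.sq_eq e a ha ha0 hyp c hc
    (hA.isOfHodgeType_of_mem_weilClassesOf hcW) hcW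

/-- **The residual for every `k`, modulo Markman's UNREFEREED Thm. 1.5.1 and (H).** [cite: Markman2025SecantWeil, Thm. 1.5.1] -/
theorem weilClassesAlgebraicAt_of_markman_of_hyperbolic (hM : Markman2025_weilClasses_algebraic_hyperbolicSixfold) {d : ℕ}
    (hH : QuarticCMWeilSixfoldHyperbolicAt d) : QuarticCMWeilClassesAlgebraicAt d :=
  fun A φ hA c hc hcW ↦
    weilClassesAlgebraicAt_of_sixfoldSlice_of_hyperbolic (d := d)
      (fun Z φZ hZ hZsp hφZ e a ha ha0 hyp c hc hcc hcW ↦ hM d hA.pos Z φZ hZ hZsp hφZ e a ha ha0 hyp c hc hcc hcW)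
      hH A φ hA c hc hcW

/-- **The residual at `k = ℚ(i)` from REFEREED print (Koike 2004, Cor. 2.1) and (H).** [cite: Koike2004WeilHodge, Cor. 2.1] -/
theorem weilClassesAlgebraicAt_one_of_koike_of_hyperbolic (hK : Koike2004_weilClasses_algebraic_hyperbolicSixfold_one)
    (hH : QuarticCMWeilSixfoldHyperbolicAt 1) : QuarticCMWeilClassesAlgebraicAt 1 :=
  weilClassesAlgebraicAt_of_sixfoldSlice_of_hyperbolic (d := 1)
    (fun Z φZ hZ hZsp hφZ e a ha ha0 hyp c hc hcc hcW ↦ hK Z φZ hZ hZsp hφZ e a ha ha0 hyp c hc hcc hcW) hH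

/-- **The residual at `k = ℚ(√-3)` from REFEREED print (Schoen 1988 / 1998) and (H).** [cite: Schoen1998HodgeWeilAddendum]
[cite: Schoen1988HodgeWeil, Thm. 0.2] -/
theorem weilClassesAlgebraicAt_three_of_schoen_of_hyperbolic (hS : Schoen1998_weilClasses_algebraic_hyperbolicSixfold_three)
    (hH : QuarticCMWeilSixfoldHyperbolicAt 3) : QuarticCMWeilClassesAlgebraicAt 3 :=
  weilClassesAlgebraicAt_of_sixfoldSlice_of_hyperbolic (d := 3)
    (fun Z φZ hZ hZsp hφZ e a ha ha0 hyp c hc hcc hcW ↦ hS Z φZ hZ hZsp hφZ e a ha ha0 hyp c hc hcc hcW) hH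

/-- **ROW `g6.IV(2,1).kE0.Weil-k`, `k = ℚ(i)`, ALL POWERS, from refereed print + (H) + (G); `HC_CM` ABSENT.**
[cite: Koike2004WeilHodge, Cor. 2.1] [cite: MoonenZarhin1999LowDim, Thm. 0.2] -/
theorem hcOnClass_powerClassAt_one_of_koike (hK : Koike2004_weilClasses_algebraic_hyperbolicSixfold_one)
    (hH : QuarticCMWeilSixfoldHyperbolicAt 1) (hG : QuarticCMWeilSixfoldGeneratedAt 1) :
    HCOnClass (QuarticCMWeilSixfoldPowerClassAt 1) :=
  hcOnClass_powerClassAt_of_weilClassesAlgebraic_of_generated (weilClassesAlgebraicAt_one_of_koike_of_hyperbolic hK hH) hG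

/-- **ROW `g6.IV(2,1).kE0.Weil-k`, `k = ℚ(√-3)`, ALL POWERS, from refereed print + (H) + (G); `HC_CM` ABSENT.**
[cite: Schoen1998HodgeWeilAddendum] [cite: MoonenZarhin1999LowDim, Thm. 0.2] -/
theorem hcOnClass_powerClassAt_three_of_schoen (hS : Schoen1998_weilClasses_algebraic_hyperbolicSixfold_three)
    (hH : QuarticCMWeilSixfoldHyperbolicAt 3) (hG : QuarticCMWeilSixfoldGeneratedAt 3) :
    HCOnClass (QuarticCMWeilSixfoldPowerClassAt 3) :=
  hcOnClass_powerClassAt_of_weilClassesAlgebraic_of_generated (weilClassesAlgebraicAt_three_of_schoen_of_hyperbolic hS hH) hG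

/-- **ROW, every `k`, ALL POWERS, modulo Markman's UNREFEREED Thm. 1.5.1 + (H) + (G) at every `d`; `HC_CM` ABSENT.**
[cite: Markman2025SecantWeil, Thm. 1.5.1] [cite: MoonenZarhin1999LowDim, Thm. 0.2] -/
theorem hcOnClass_powerClass_of_markman (hM : Markman2025_weilClasses_algebraic_hyperbolicSixfold)
    (hH : ∀ d, 0 < d → QuarticCMWeilSixfoldHyperbolicAt d) (hG : ∀ d, 0 < d → QuarticCMWeilSixfoldGeneratedAt d) :
    HCOnClass QuarticCMWeilSixfoldPowerClass := by
  rintro X ⟨d, A, φ, N, hA, hX⟩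
  exact hcOnClass_powerClassAt_of_weilClassesAlgebraic_of_generated
    (weilClassesAlgebraicAt_of_markman_of_hyperbolic hM (hH d hA.pos)) (hG d hA.pos) X ⟨A, φ, N, hA, hX⟩

/-- **FACTOR form**: if `X × Y` is isogenous to a power of a member (e.g. `X` an abelian subvariety of `A^{N+1}` up to isogeny, `Y` a
Poincaré complement), then HC(`X`) — restriction to the slice `X × {0}` (`hodgeConjectureFor_left_of_prod`).
[cite: vanGeemen1994HodgeAV, Lemma 3.7] [cite: Fulton1998, §19.2] -/
theorem hodgeConjectureFor_of_prod_isIsogenous_powSucc {d : ℕ} (hW : QuarticCMWeilClassesAlgebraicAt d)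
    (hG : QuarticCMWeilSixfoldGeneratedAt d) (X Y : AbelianVariety ℂ) {A : AbelianVariety ℂ} {φ : A ⟶ A}
    (hA : IsQuarticCMWeilSixfoldWith A φ d) (N : ℕ) (hXY : AbelianVariety.IsIsogenous (X.prod Y) (A.powSucc N)) :
    HodgeConjectureFor X.dim X.X :=
  hodgeConjectureFor_left_of_prod X Y
    (hcOnClass_powerClassAt_of_weilClassesAlgebraic_of_generated hW hG (X.prod Y) ⟨A, φ, N, hA, hXY⟩)

/-! ## §4 On path: every row is a case of `HC_AV`, of the summit, and the residual is a case of `HCAtDim 6` -/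

/-- ON-PATH: the power class row is a case of `HC_AV` (stmt-HodgeConjecture-1333 by name) — so this file REPLACES `HC_AV` on the row
by `hK`/`hS`/`hM` + (H) + (G); it is not summit progress. [cite: Deligne2000, §1] -/
theorem hcOnClass_powerClass_of_hodgeAbelianVarieties (h : PadicSemiregularLift.HodgeAbelianVarieties) :
    HCOnClass QuarticCMWeilSixfoldPowerClass :=
  fun X _ ↦ h X

/-- ON-PATH: … and of the summit. [cite: Deligne2000, §1] -/
theorem hcOnClass_powerClass_of_hodgeConjecture (h : _root_.HodgeConjecture) : HCOnClass QuarticCMWeilSixfoldPowerClass :=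
  fun X _ ↦ h (AbelianVariety.isSmoothProjective_holds (A := X))

/-- ON-PATH: the power class at one `d` is a case of `HC_AV`. [cite: Deligne2000, §1] -/
theorem hcOnClass_powerClassAt_of_hodgeAbelianVarieties (h : PadicSemiregularLift.HodgeAbelianVarieties) (d : ℕ) :
    HCOnClass (QuarticCMWeilSixfoldPowerClassAt d) :=
  fun X _ ↦ h X

/-- ON-PATH inside the kernel frame: the residual price is a case of the row `HCAtDim 6` (the members are sixfolds).
[cite: Deligne2000, §1] -/
theorem weilClassesAlgebraicAt_of_hcAtDim_six (h : HCAtDim 6) (d : ℕ) : QuarticCMWeilClassesAlgebraicAt d :=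
  fun A _ hA _ hc hcW ↦ hA.weilClass_mem_algebraicClasses_of_hodgeConjectureFor (h A hA.dim_eq) hc hcW

/-- ON-PATH: the residual price is a case of `HC_AV`. [cite: Deligne2000, §1] -/
theorem weilClassesAlgebraicAt_of_hodgeAbelianVarieties (h : PadicSemiregularLift.HodgeAbelianVarieties) (d : ℕ) :
    QuarticCMWeilClassesAlgebraicAt d :=
  fun A _ hA _ hc hcW ↦ hA.weilClass_mem_algebraicClasses_of_hodgeConjectureFor (h A) hc hcW

end Summit.HodgeConjecture.HodgeConjecture.Ring2.Motiv

end
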